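/-
Copyright: the b2b-balaban T⁴-continuum CRUX team, row NE7b OWNER lineage `t4-ne7b-p1` (gen 147). Project licence.
-/
import Mathlib

/-!
# THE WEIGHTED KERNEL LETTERS TRANSPORT THROUGH THE RESCALING BY EXACT POWER COUNTING ((433) §4–§5 with weights; SCOPING-d17 (N3) ∕
# (R-d); file (766)).  (433) decided the letter format of the class: a `k`-linear piece with kernel `T` on the fine sites becomes, through the
# canonical rescaling `A = t • J_β` (block map `β` with fibres of `≤ n` sites, field normalisation `t`), the coarse kernel
# `T′ = t^k·Σ_{fibres}T` whose PLAIN row sums are `≤ |t|^k·n·κ`.  The weighted class ((748)–(765)) carries WEIGHTED letters — at order 2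
# `Σ_b ϑ(a,b)·K_{ab} ≤ κ` (rows), `Σ_b ϑ(a,b)·K_{ba} ≤ κc` (columns), at order 3 the full-graph letters `Σ_{y,v}K3_{xyv}ϑ(x,y)ϑ(x,v)ϑ(y,v) ≤ κ₃`
# — for the nonnegative MAJORANTS `K` of the kernels, and the iteration closes only if these transport too: the OUTPUT letters at the
# output weight `ϑ` on the fine lattice must become the INPUT letters at the weight `ϑ₂` of the next step on the coarse lattice.  THIS FILE
# is that transport: if the coarse weight is dominated on block images, `ϑc(βx,βx′) ≤ M·ϑ(x,x′)` (for exponential weights of rates `νc` on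
# the coarse and `ν` on the fine lattice with `d_c(βx,βx′) ≤ (d(x,x′) + 2·diam)/L`: `νc = L·ν` and `M = e^{2νc·diam∕L}` — (672)
# `expw_rescale`; not typed here), then the coarse majorant `K′ = t^k·Σ_{fibres}K` (which dominates the coarse kernel's entries, §1) has
#   rows `Σ_{y₂} ϑc(y₁,y₂)·K′_{y₁y₂} ≤ t²·n·M·κ`,  columns `≤ t²·n·M·κc`  (order 2, §2),
#   full-graph letter `Σ_{y₂,y₃} K3′_{y₁y₂y₃}·ϑc(y₁,y₂)ϑc(y₁,y₃)ϑc(y₂,y₃) ≤ |t|³·n·M³·κ₃`  (order 3, first index, §3)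
# — exact power counting `|t|^k·n` times the block factor, in the SLOT shapes of the class files (row NE7b, node U5c; Mathlib only;
# [folklore] finite sums).  With (748)–(765) this is the last bookkeeping link of the weighted class map's iteration: output `ϑ`-letters
# (fine) ⟹ input `ϑ₂`-letters (coarse, `ν₂ = L·ν`), the letter VALUES multiplying by `|t|^k·n·M^{#edges}` per step.

Cell `pub-balaban`, sub-cell `t4`, spine estimate NE7b (`T4WeightBudget.RelWeightBound`; the cell's OWN estimate — NOT PRINTED in
[Bałaban 1983–89], NOT PROVED).  Crux-route work under `Spine/NE7b/` by the row OWNER (`t4-ne7b-p1` gen 147, file (766)) under FREEZE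
(0)'s crux-prover clause; NOTHING of Bałaban's is named as a Lean object, valued or asserted; no `T4Continuum/Support` leaf typed; no
`def`, no notation (the coarse majorants WRITTEN OUT); zero `sorry`.  Imports: Mathlib only; (433) met BY SHAPE.

WHAT IS PROVED ([folklore]; `β : ι → ι′` with fibres of `≤ n` sites, `K ≥ 0`, `K3 ≥ 0`, weights `ϑ` (fine), `ϑc` (coarse) with
`ϑc(βx,βx′) ≤ M·ϑ(x,x′)`, `M ≥ 0`):
* §1 `coarse_majorant_dominates` (`|T| ≤ K ⟹ |t²Σ_{fibres}T| ≤ t²Σ_{fibres}K`), `coarse_majorant_nonneg`.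
* §2 **`weighted_coarse_rowsum_le`** (rows `≤ t²·n·M·κ`), **`weighted_coarse_colsum_le`** (columns `≤ t²·n·M·κc`).
* §3 **`weighted_coarse_k3_letter_le`** (order 3, first index fixed: `≤ |t|³·n·M³·κ₃`).
* §4 toy.

HONEST (what this is NOT).  Finite-sum bookkeeping: the block geometry (`n = L⁴`, the diameter factor `M`), the orders 4–5 and the other
roles at order 3 (same proof, one fibre count on the fixed index), and the FLOW of the letter values (`× |t|^k·n·M^{#edges}` per step
against the road's smallness — (433)∕(436), NOT claimed) are not typed here; scalar skeleton ((A3), NC-NE7b-α UNRULED); nothing of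
Bałaban's asserted.  BY-NAME EFFECT ON THE WALL: NONE.  NE7b NOT PRINTED ∕ NOT PROVED; spine PROVED 0∕9; rung (B)+1 — the programme's
measures remain FINITE-torus statements; NOT the mass gap, NOT Clay.  HONEST DEPENDENCY: continuum YM on T⁴ ⇐ BetaPertH ∧ nine spine
estimates (0∕9 proved); BetaPertH ⇐ (D1) ∧ (D4) ∧ CAP+tail; G-an2-4 gates asym, D1 and NE2∕3∕4.
-/

set_option autoImplicit false

noncomputable section

namespace Summit.QuantumFields.BalabanUV.T4Continuum.NE7b.SupWeightedKernelLetterTransport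

open Finset
open scoped BigOperators

variable {ι ι' : Type} [Fintype ι] [Fintype ι'] [DecidableEq ι']

/-! ## §1. The coarse majorant -/

omit [Fintype ι'] in
/-- **The coarse majorant dominates the coarse kernel**: `|T x x′| ≤ K x x′ ⟹ |t²Σ_{βx=y₁}Σ_{βx′=y₂}T x x′| ≤ t²Σ_{βx=y₁}Σ_{βx′=y₂}K x x′`.
[folklore] -/
theorem coarse_majorant_dominates (β : ι → ι') (T K : ι → ι → ℝ) (hTK : ∀ x x', |T x x'| ≤ K x x') (t : ℝ) (y₁ y₂ : ι') :
    |t ^ 2 * ∑ x ∈ univ.filter (fun x => β x = y₁), ∑ x' ∈ univ.filter (fun x' => β x' = y₂), T x x'| ≤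
      t ^ 2 * ∑ x ∈ univ.filter (fun x => β x = y₁), ∑ x' ∈ univ.filter (fun x' => β x' = y₂), K x x' := by
  rw [abs_mul, abs_of_nonneg (sq_nonneg t)]
  refine mul_le_mul_of_nonneg_left ?_ (sq_nonneg t)
  exact (abs_sum_le_sum_abs _ _).trans (sum_le_sum fun x _ => (abs_sum_le_sum_abs _ _).trans (sum_le_sum fun x' _ => hTK x x'))

omit [Fintype ι'] in
/-- The coarse majorant is nonnegative. [folklore] -/
theorem coarse_majorant_nonneg (β : ι → ι') (K : ι → ι → ℝ) (hK : ∀ x x', 0 ≤ K x x') (t : ℝ) (y₁ y₂ : ι') :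
    0 ≤ t ^ 2 * ∑ x ∈ univ.filter (fun x => β x = y₁), ∑ x' ∈ univ.filter (fun x' => β x' = y₂), K x x' :=
  mul_nonneg (sq_nonneg t) (sum_nonneg fun x _ => sum_nonneg fun x' _ => hK x x')

/-! ## §2. Order 2: weighted rows and columns of the coarse majorant -/

/-- **WEIGHTED ROWS TRANSPORT BY EXACT POWER COUNTING**: fibres of `≤ n` sites, fine weighted rows `Σ_{x′}ϑ(x,x′)K x x′ ≤ κ`, and a coarse
weight dominated on block images `ϑc(βx,βx′) ≤ M·ϑ(x,x′)` give coarse weighted rows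
`Σ_{y₂} ϑc(y₁,y₂)·(t²Σ_{βx=y₁}Σ_{βx′=y₂}K x x′) ≤ t²·n·M·κ` — the slot shape `Σ_b ϑ₂(a,b)·Hk⁺(a,b)` of the next step's input. [folklore] -/
theorem weighted_coarse_rowsum_le (β : ι → ι') {n : ℕ} (hfib : ∀ y, (univ.filter fun x => β x = y).card ≤ n) (K : ι → ι → ℝ)
    (hK : ∀ x x', 0 ≤ K x x') {ϑ : ι → ι → ℝ} {ϑc : ι' → ι' → ℝ} {M κ : ℝ} (hM : 0 ≤ M) (hϑ : ∀ x x', ϑc (β x) (β x') ≤ M * ϑ x x')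
    (hκ : 0 ≤ κ) (hrow : ∀ x, ∑ x', ϑ x x' * K x x' ≤ κ) (t : ℝ) (y₁ : ι') :
    ∑ y₂, ϑc y₁ y₂ * (t ^ 2 * ∑ x ∈ univ.filter (fun x => β x = y₁), ∑ x' ∈ univ.filter (fun x' => β x' = y₂), K x x') ≤
      t ^ 2 * n * M * κ := by
  calc ∑ y₂, ϑc y₁ y₂ * (t ^ 2 * ∑ x ∈ univ.filter (fun x => β x = y₁), ∑ x' ∈ univ.filter (fun x' => β x' = y₂), K x x')
      = t ^ 2 * ∑ y₂, ∑ x ∈ univ.filter (fun x => β x = y₁), ∑ x' ∈ univ.filter (fun x' => β x' = y₂), ϑc y₁ y₂ * K x x' := by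
        rw [mul_sum]
        refine sum_congr rfl fun y₂ _ => ?_
        rw [mul_left_comm, mul_sum]
        exact congrArg _ (sum_congr rfl fun x _ => mul_sum _ _ _)
    _ = t ^ 2 * ∑ x ∈ univ.filter (fun x => β x = y₁), ∑ y₂, ∑ x' ∈ univ.filter (fun x' => β x' = y₂), ϑc y₁ y₂ * K x x' := by
        rw [sum_comm]
    _ ≤ t ^ 2 * ∑ x ∈ univ.filter (fun x => β x = y₁), ∑ y₂, ∑ x' ∈ univ.filter (fun x' => β x' = y₂), M * (ϑ x x' * K x x') := by
        refine mul_le_mul_of_nonneg_left (sum_le_sum fun x hx => sum_le_sum fun y₂ _ => sum_le_sum fun x' hx' => ?_) (sq_nonneg t)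
        rw [← (mem_filter.1 hx).2, ← (mem_filter.1 hx').2, ← mul_assoc]
        exact mul_le_mul_of_nonneg_right (hϑ x x') (hK x x')
    _ = t ^ 2 * ∑ x ∈ univ.filter (fun x => β x = y₁), M * ∑ x', ϑ x x' * K x x' := by
        congr 1
        refine sum_congr rfl fun x _ => ?_
        rw [mul_sum]
        exact sum_fiberwise univ β fun x' => M * (ϑ x x' * K x x')
    _ ≤ t ^ 2 * ∑ x ∈ univ.filter (fun x => β x = y₁), M * κ := by
        gcongr with x _
        exact hrow x
    _ = t ^ 2 * ((univ.filter fun x => β x = y₁).card * (M * κ)) := by rw [sum_const, nsmul_eq_mul]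
    _ ≤ t ^ 2 * (n * (M * κ)) :=
        mul_le_mul_of_nonneg_left (mul_le_mul_of_nonneg_right (by exact_mod_cast hfib y₁) (mul_nonneg hM hκ)) (sq_nonneg t)
    _ = t ^ 2 * n * M * κ := by ring

/-- **WEIGHTED COLUMNS**: fine weighted columns `Σ_b ϑ(a,b)K b a ≤ κc` give coarse weighted columns
`Σ_{y₂} ϑc(y₁,y₂)·(t²Σ_{βx=y₂}Σ_{βx′=y₁}K x x′) ≤ t²·n·M·κc` (the slot shape `Σ_b ϑ₂(a,b)·Hk⁺(b,a)`; the fibre count is on the fixed index,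
the symmetry of the weights is not needed if the domination is stated as `ϑc(βx′,βx) ≤ M·ϑ(x′,x)` — here both orders follow from `hϑ`).
[folklore] -/
theorem weighted_coarse_colsum_le (β : ι → ι') {n : ℕ} (hfib : ∀ y, (univ.filter fun x => β x = y).card ≤ n) (K : ι → ι → ℝ)
    (hK : ∀ x x', 0 ≤ K x x') {ϑ : ι → ι → ℝ} {ϑc : ι' → ι' → ℝ} {M κc : ℝ} (hM : 0 ≤ M) (hϑ : ∀ x x', ϑc (β x) (β x') ≤ M * ϑ x x')
    (hκ : 0 ≤ κc) (hcol : ∀ a, ∑ b, ϑ a b * K b a ≤ κc) (t : ℝ) (y₁ : ι') :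
    ∑ y₂, ϑc y₁ y₂ * (t ^ 2 * ∑ x ∈ univ.filter (fun x => β x = y₂), ∑ x' ∈ univ.filter (fun x' => β x' = y₁), K x x') ≤
      t ^ 2 * n * M * κc := by
  -- swap the two fibre sums: the column majorant is the row majorant of the transposed kernel `fun a b => K b a`
  have hswap : ∀ y₂, (∑ x ∈ univ.filter (fun x => β x = y₂), ∑ x' ∈ univ.filter (fun x' => β x' = y₁), K x x') =
      ∑ x' ∈ univ.filter (fun x' => β x' = y₁), ∑ x ∈ univ.filter (fun x => β x = y₂), (fun a b => K b a) x' x := fun y₂ => sum_comm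
  simp_rw [hswap]
  exact weighted_coarse_rowsum_le β hfib (fun a b => K b a) (fun a b => hK b a) hM hϑ hκ hcol t y₁

/-! ## §3. Order 3: the full-graph letter of the coarse majorant, first index fixed -/

/-- **ORDER 3, EXACT POWER COUNTING WITH FULL-GRAPH WEIGHTS**: fibres of `≤ n` sites, the fine full-graph letter
`Σ_{y,v}K3 x y v·ϑ(x,y)ϑ(x,v)ϑ(y,v) ≤ κ₃` (first index fixed) and `ϑc(βx,βx′) ≤ M·ϑ(x,x′)` give, for the coarse majorant
`K3′ y₁ y₂ y₃ = |t|³Σ_{βx=y₁}Σ_{βx′=y₂}Σ_{βx″=y₃}K3 x x′ x″`, the coarse letter `Σ_{y₂,y₃}K3′·ϑc(y₁,y₂)ϑc(y₁,y₃)ϑc(y₂,y₃) ≤ |t|³·n·M³·κ₃`. [folklore] -/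
theorem weighted_coarse_k3_letter_le (β : ι → ι') {n : ℕ} (hfib : ∀ y, (univ.filter fun x => β x = y).card ≤ n) (K3 : ι → ι → ι → ℝ)
    (hK : ∀ x y v, 0 ≤ K3 x y v) {ϑ : ι → ι → ℝ} {ϑc : ι' → ι' → ℝ} {M κ₃ : ℝ} (hM : 0 ≤ M) (hϑ0 : ∀ x x', 0 ≤ ϑ x x')
    (hϑc0 : ∀ y y', 0 ≤ ϑc y y') (hϑ : ∀ x x', ϑc (β x) (β x') ≤ M * ϑ x x') (hκ : 0 ≤ κ₃)
    (hk3 : ∀ x, ∑ y, ∑ v, K3 x y v * (ϑ x y * ϑ x v * ϑ y v) ≤ κ₃) (t : ℝ) (y₁ : ι') :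
    ∑ y₂, ∑ y₃, (|t| ^ 3 * ∑ x ∈ univ.filter (fun x => β x = y₁), ∑ x' ∈ univ.filter (fun x' => β x' = y₂),
        ∑ x'' ∈ univ.filter (fun x'' => β x'' = y₃), K3 x x' x'') * (ϑc y₁ y₂ * ϑc y₁ y₃ * ϑc y₂ y₃) ≤ |t| ^ 3 * n * M ^ 3 * κ₃ := by
  have ht3 : 0 ≤ |t| ^ 3 := by positivity
  have hW : ∀ x x' x'', ϑc (β x) (β x') * ϑc (β x) (β x'') * ϑc (β x') (β x'') ≤ M ^ 3 * (ϑ x x' * ϑ x x'' * ϑ x' x'') :=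
    fun x x' x'' =>
    calc ϑc (β x) (β x') * ϑc (β x) (β x'') * ϑc (β x') (β x'')
        ≤ M * ϑ x x' * (M * ϑ x x'') * (M * ϑ x' x'') :=
          mul_le_mul (mul_le_mul (hϑ x x') (hϑ x x'') (hϑc0 _ _) (mul_nonneg hM (hϑ0 x x'))) (hϑ x' x'') (hϑc0 _ _)
            (mul_nonneg (mul_nonneg hM (hϑ0 x x')) (mul_nonneg hM (hϑ0 x x'')))
      _ = M ^ 3 * (ϑ x x' * ϑ x x'' * ϑ x' x'') := by ring
  calc ∑ y₂, ∑ y₃, (|t| ^ 3 * ∑ x ∈ univ.filter (fun x => β x = y₁), ∑ x' ∈ univ.filter (fun x' => β x' = y₂),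
          ∑ x'' ∈ univ.filter (fun x'' => β x'' = y₃), K3 x x' x'') * (ϑc y₁ y₂ * ϑc y₁ y₃ * ϑc y₂ y₃)
      = |t| ^ 3 * ∑ y₂, ∑ y₃, ∑ x ∈ univ.filter (fun x => β x = y₁), ∑ x' ∈ univ.filter (fun x' => β x' = y₂),
          ∑ x'' ∈ univ.filter (fun x'' => β x'' = y₃), K3 x x' x'' * (ϑc y₁ y₂ * ϑc y₁ y₃ * ϑc y₂ y₃) := by
        rw [mul_sum]
        refine sum_congr rfl fun y₂ _ => ?_
        rw [mul_sum]
        refine sum_congr rfl fun y₃ _ => ?_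
        rw [mul_assoc, sum_mul]
        refine congrArg _ (sum_congr rfl fun x _ => ?_)
        rw [sum_mul]
        exact sum_congr rfl fun x' _ => sum_mul _ _ _
    _ = |t| ^ 3 * ∑ x ∈ univ.filter (fun x => β x = y₁), ∑ y₂, ∑ x' ∈ univ.filter (fun x' => β x' = y₂), ∑ y₃,
          ∑ x'' ∈ univ.filter (fun x'' => β x'' = y₃), K3 x x' x'' * (ϑc y₁ y₂ * ϑc y₁ y₃ * ϑc y₂ y₃) := by
        congr 1
        calc ∑ y₂, ∑ y₃, ∑ x ∈ univ.filter (fun x => β x = y₁), ∑ x' ∈ univ.filter (fun x' => β x' = y₂),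
              ∑ x'' ∈ univ.filter (fun x'' => β x'' = y₃), K3 x x' x'' * (ϑc y₁ y₂ * ϑc y₁ y₃ * ϑc y₂ y₃)
            = ∑ y₂, ∑ x ∈ univ.filter (fun x => β x = y₁), ∑ y₃, ∑ x' ∈ univ.filter (fun x' => β x' = y₂),
              ∑ x'' ∈ univ.filter (fun x'' => β x'' = y₃), K3 x x' x'' * (ϑc y₁ y₂ * ϑc y₁ y₃ * ϑc y₂ y₃) :=
              sum_congr rfl fun y₂ _ => sum_comm
          _ = ∑ x ∈ univ.filter (fun x => β x = y₁), ∑ y₂, ∑ y₃, ∑ x' ∈ univ.filter (fun x' => β x' = y₂),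
              ∑ x'' ∈ univ.filter (fun x'' => β x'' = y₃), K3 x x' x'' * (ϑc y₁ y₂ * ϑc y₁ y₃ * ϑc y₂ y₃) := sum_comm
          _ = ∑ x ∈ univ.filter (fun x => β x = y₁), ∑ y₂, ∑ x' ∈ univ.filter (fun x' => β x' = y₂), ∑ y₃,
              ∑ x'' ∈ univ.filter (fun x'' => β x'' = y₃), K3 x x' x'' * (ϑc y₁ y₂ * ϑc y₁ y₃ * ϑc y₂ y₃) :=
              sum_congr rfl fun x _ => sum_congr rfl fun y₂ _ => sum_comm
    _ ≤ |t| ^ 3 * ∑ x ∈ univ.filter (fun x => β x = y₁), ∑ y₂, ∑ x' ∈ univ.filter (fun x' => β x' = y₂), ∑ y₃,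
          ∑ x'' ∈ univ.filter (fun x'' => β x'' = y₃), M ^ 3 * (K3 x x' x'' * (ϑ x x' * ϑ x x'' * ϑ x' x'')) := by
        refine mul_le_mul_of_nonneg_left (sum_le_sum fun x hx => sum_le_sum fun y₂ _ => sum_le_sum fun x' hx' =>
          sum_le_sum fun y₃ _ => sum_le_sum fun x'' hx'' => ?_) ht3
        rw [← (mem_filter.1 hx).2, ← (mem_filter.1 hx').2, ← (mem_filter.1 hx'').2]
        calc K3 x x' x'' * (ϑc (β x) (β x') * ϑc (β x) (β x'') * ϑc (β x') (β x''))
            ≤ K3 x x' x'' * (M ^ 3 * (ϑ x x' * ϑ x x'' * ϑ x' x'')) := mul_le_mul_of_nonneg_left (hW x x' x'') (hK x x' x'')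
          _ = M ^ 3 * (K3 x x' x'' * (ϑ x x' * ϑ x x'' * ϑ x' x'')) := by ring
    _ = |t| ^ 3 * ∑ x ∈ univ.filter (fun x => β x = y₁), M ^ 3 * ∑ x', ∑ x'', K3 x x' x'' * (ϑ x x' * ϑ x x'' * ϑ x' x'') := by
        congr 1
        refine sum_congr rfl fun x _ => ?_
        rw [mul_sum]
        calc ∑ y₂, ∑ x' ∈ univ.filter (fun x' => β x' = y₂), ∑ y₃, ∑ x'' ∈ univ.filter (fun x'' => β x'' = y₃),
              M ^ 3 * (K3 x x' x'' * (ϑ x x' * ϑ x x'' * ϑ x' x''))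
            = ∑ y₂, ∑ x' ∈ univ.filter (fun x' => β x' = y₂), ∑ x'', M ^ 3 * (K3 x x' x'' * (ϑ x x' * ϑ x x'' * ϑ x' x'')) :=
              sum_congr rfl fun y₂ _ => sum_congr rfl fun x' _ =>
                sum_fiberwise univ β fun x'' => M ^ 3 * (K3 x x' x'' * (ϑ x x' * ϑ x x'' * ϑ x' x''))
          _ = ∑ x', ∑ x'', M ^ 3 * (K3 x x' x'' * (ϑ x x' * ϑ x x'' * ϑ x' x'')) :=
              sum_fiberwise univ β fun x' => ∑ x'', M ^ 3 * (K3 x x' x'' * (ϑ x x' * ϑ x x'' * ϑ x' x''))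
          _ = ∑ x', M ^ 3 * ∑ x'', K3 x x' x'' * (ϑ x x' * ϑ x x'' * ϑ x' x'') := sum_congr rfl fun x' _ => (mul_sum _ _ _).symm
    _ ≤ |t| ^ 3 * ∑ x ∈ univ.filter (fun x => β x = y₁), M ^ 3 * κ₃ := by
        gcongr with x _
        exact hk3 x
    _ = |t| ^ 3 * ((univ.filter fun x => β x = y₁).card * (M ^ 3 * κ₃)) := by rw [sum_const, nsmul_eq_mul]
    _ ≤ |t| ^ 3 * (n * (M ^ 3 * κ₃)) :=
        mul_le_mul_of_nonneg_left (mul_le_mul_of_nonneg_right (by exact_mod_cast hfib y₁) (mul_nonneg (pow_nonneg hM 3) hκ)) ht3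
    _ = |t| ^ 3 * n * M ^ 3 * κ₃ := by ring

/-! ## §4. Toy -/

/-- Toy (order 2 on one block of two sites collapsed to a point, `t = 1`, unit weights, `M = 1`): the fine kernel `K ≡ 1` on `Fin 2` has
weighted rows `2`, the coarse majorant is the single entry `4 ≤ 1²·2·1·2`. -/
example : ∑ y₂ : Fin 1, (1 : ℝ) * ((1 : ℝ) ^ 2 * ∑ x ∈ univ.filter (fun x : Fin 2 => (fun _ => (0 : Fin 1)) x = (0 : Fin 1)),
      ∑ x' ∈ univ.filter (fun x' : Fin 2 => (fun _ => (0 : Fin 1)) x' = y₂), (fun _ _ => (1 : ℝ)) x x') ≤ (1 : ℝ) ^ 2 * (2 : ℕ) * 1 * 2 :=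
  weighted_coarse_rowsum_le (fun _ : Fin 2 => (0 : Fin 1)) (n := 2) (fun y => by fin_cases y; simp) (fun _ _ => (1 : ℝ))
    (fun _ _ => zero_le_one)
    (ϑ := fun _ _ => (1 : ℝ)) (ϑc := fun _ _ => (1 : ℝ)) zero_le_one (fun _ _ => by norm_num) (by norm_num) (fun x => by simp) 1 0

end Summit.QuantumFields.BalabanUV.T4Continuum.NE7b.SupWeightedKernelLetterTransport

end
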